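import Summits.Ventures.PercRepro.RankLevelSetFrameQM

/-!
# PercRepro — C-025 FOR EVERY PAVING MATROID, AT EVERY `(p, q)` (night-1, gen 6)

A corollary of p3's Theorem G′ (`c025_of_circuits`, RankLevelSetG: every circuit of `≥ q + 2` elements gives
the `C025` body at `(p, q)`) and p2's `RLS_of_eRank_lt` (`ρ(E) < p` ⇒ `U(p, q) = ∅`): a PAVING matroid — every
circuit has at least `ρ(E)` elements — satisfies C-025 at every pair `q + 2 ≤ p`. Either `ρ(E) < p`, and no set has
rank `p`; or `ρ(E) ≥ p ≥ q + 2`, and every circuit has `≥ q + 2` elements. Sparse paving matroids and the uniform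
matroids `U_{r,n}` are paving (mine-2 §7 states the corollary in prose: «paving matroids are covered»). This is the
class conjectured (Mayhew–Newman–Welsh–Whittle 2011) to contain asymptotically almost all matroids.

* **`c025_of_paving`** — `RLS M p q` for every paving `M` and every `q + 2 ≤ p`;
* **`c025_of_paving'`** — the same in the literal `C025` body;
* `c025_of_paving_all` — the `∀ p q` form for one matroid.
Axioms: standard.
-/

open scoped Matroid

namespace PercRepro

namespace ThmN

variable {α : Type}

/-- **C-025 for paving matroids**: if every circuit of `M` has at least `ρ(E)` elements, then `RLS M p q` for every
`q + 2 ≤ p`. -/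
theorem c025_of_paving (M : Matroid α) [M.Finite]
    (hpav : ∀ C, M.IsCircuit C → M.eRank ≤ C.encard) (p q : ℕ) (hqp : q + 2 ≤ p) : RLS M p q := by
  rcases lt_or_ge M.eRank (p : ℕ∞) with h | h
  · exact RLS_of_eRank_lt M h
  · refine RLS_of_circuits M (fun C hC => ?_)
    have h1 : ((q + 2 : ℕ) : ℕ∞) ≤ (p : ℕ∞) := by exact_mod_cast hqp
    exact h1.trans (h.trans (hpav C hC))

/-- **C-025 for paving matroids, the literal `C025` body.** -/
theorem c025_of_paving' (M : Matroid α) [M.Finite]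
    (hpav : ∀ C, M.IsCircuit C → M.eRank ≤ C.encard) (p q : ℕ) (hqp : q + 2 ≤ p) :
    phiK p q * ({A : Set α | A ⊆ M.E ∧ M.eRk A = (p : ℕ∞) ∧ M.eRk (M.E \ A) = (q : ℕ∞)}.ncard : ℚ) ≤
      ({A : Set α | A ⊆ M.E ∧ (q : ℕ∞) < M.eRk A ∧ M.eRk A < (p : ℕ∞)}.ncard : ℚ) :=
  c025_of_paving M hpav p q hqp

/-- **C-025 for paving matroids, all pairs at once.** -/
theorem c025_of_paving_all (M : Matroid α) [M.Finite]
    (hpav : ∀ C, M.IsCircuit C → M.eRank ≤ C.encard) : ∀ p q : ℕ, q + 2 ≤ p → RLS M p q :=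
  fun p q hqp => c025_of_paving M hpav p q hqp

end ThmN

end PercRepro
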